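import Summits.QuantumFields.BalabanUV.Beta.GAN24.CarrierKernelLegBlockL1
import Summits.QuantumFields.BalabanUV.Beta.GAN24.CarrierSlotLegBottomKernel

/-!
# `BalabanUV.Beta.GAN24.CarrierKernelLegBottomKernel` — binder row G-an2-4 ∕ (CONV-C), W-slot, the (α-0) parity re-cut, located crux (Q-L-k₀), the DRIFT rows
# (leaf-03 g68 A-4∕A-5: the composite kernel-DIFFERENCE windows (H1Δw) — a `(q+1)`-chain from level `l+1` whose FIRST step carries `K♮ᴱ_{l+1} − K♮ᴱ_l` (or `K♮ᴱ_l`) in one leg;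
# OWNER `b2b-balaban-gan24-p1` gen 37, part 8a — THE KERNEL-LEG SIDE):
# **THE CARRIER's COMPOSITE KERNEL LEG WITH AN ARBITRARY DECAYING KERNEL AT ITS LOWEST LEVEL IS `CM`-SIZED IN BLOCK MASS** — for the family `K′ := update K♮ᴱ p M`,
# `Σ_{t ∈ box (Lc^{q+1})} |kChain (j ↦ krow K′_j Lc) p q α x″ f (Lc^{q+1}•c + t)| ≤ CM·K₈·(q+1)·e^{−κ₁‖c − x″‖∞}` whenever `Decays M CM δM`.

NOT IN PRINT; OUR BOOKKEEPING ([folklore] re-indexing BY NAME: MY part 4's `kChain_succ_left` ∕ `krowInl_dressed_seq`, MY part 8b's `legChain_congr_from`, part 2's chain block mass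
`DressedLegBlockL1Envelope.exists_legChain_blockL1_envelope` (p367009), part 3a's composition `DressedLegBlockL1MultiplierColumn.sum_box_abs_comp_mm_le` ∕ `summable_mul_of_decay`
(p368145) — part 3b's proof with the bottom kernel made ABSTRACT; 0 `def`, 0 cited facts, 0 `def … : Prop`, 0 sorry).  HONEST FRAMING (cell contract, verbatim): «discharging
`BetaPertH` makes Bałaban's UV stability UNCONDITIONAL — a real constructive-QFT result; it is NOT the continuum limit and NOT the Clay problem.»  HONEST DEPENDENCY (verbatim):
«continuum YM on T⁴ ⇐ BetaPertH ∧ nine spine estimates (0/9 proved); BetaPertH ⇐ (D1) ∧ (D4) ∧ CAP+tail; G-an2-4 gates asym, D1 and NE2/3/4.»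

WHAT (`d = 3`, `2 ≤ Lc`, `K♮ᴱ_j(rr)` as in part 4; `M` ANY kernel with `|M x y a b| ≤ CM·e^{−δM|x−y|₁}`):
* §1 **`exists_chain_comp_bottom_blockL1`** — part 3b generalised: `∀ δM > 0, ∃ κ₁ K′, ∀ rr M CM …, Σ_{t ∈ box (Lc^{k+2})} |Σ′_{x′} Σ_{α′} legChain (respStepBmSeq ρ Lc) (m+1) k α x″ α′ x′ ·
  M (Lc•x′) (Lc^{k+2}•c + t) (inr α′) f| ≤ CM·K′·(k+1)·(Lc^{k+1})⁻¹·e^{−κ₁‖c − x″‖∞}` (the dressed row chain above, the abstract kernel at the bottom; `κ₁ = min κ₀ (δM∕4)`).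
* §2 `kChain_update_succ` — for `K′ := Function.update K♮ᴱ p M` (M decaying): `kChain (j ↦ krow K′_j Lc) p (q+1) α x″ f x = (−1)^{q+1}·Σ′Σ legChain (respStepBmSeq ρ Lc) (p+1) q α x″ α′ x′ ·
  M (Lc•x′) x (inr α′) f` (part 4's `kChain_succ_left` ⨾ `legChain_congr_from` ⨾ `krowInl_dressed_seq` ⨾ `legChain_neg`); `kChain_update_zero`.
* §3 **`exists_kChain_bottomKernel_blockMass`** (as displayed) and the two instantiations the drift windows read (with MY part 7 `DressedStepDifferenceRows.exists_dressedStep_rows`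
  as the `Decays` input — NOT imported here to keep this file on part 4 alone; the consumer feeds `M := K♮ᴱ_{l+1} − K♮ᴱ_l`, `CM := cK·θ^l`, or `M := K♮ᴱ_l`, `CM := C`).
The SLOT-leg side of (H1Δw) (composite slot legs with the Δ ∕ mismatched factor at the bottom: sup + crude unit-gradient envelopes, `φ := 0`) and the mixed-family (trilinear)
carrier are NOT here (part 8b ∕ leaf-01).  Asserts NOTHING about Bałaban's tables; NOT (H1Δw); NOTHING of (Q-L) ∕ (C)sym discharged; NEVER «G-an2-4 closed» as (CONV-C);
NOT D1, NOT `BetaPertH`, NOT continuum, NOT Clay; not in print.  Unit `b2b-balaban-gan24-p1` (BINDER row G-an2-4 OWNER; CRUX PROVER on C-R8° CT-ROUTE), gen 37, 2026-08-23.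
-/

noncomputable section

open Finset
open scoped BigOperators
open Literature.MathematicalPhysics.QuantumFieldTheory
open Literature.MathematicalPhysics.QuantumFieldTheory.LatticeForm (quo)
open Literature.MathematicalPhysics.QuantumFieldTheory.Balaban1983to89
open Literature.MathematicalPhysics.QuantumFieldTheory.Balaban1983to89.Beta
open B4ContourShift (supNorm supNorm_nonneg)
open B12Sec2to5 (l1 l1_nonneg)
open ExpKernelCalculus (MKer Decays Zl Zl_nonneg)
open OneStepResolventKernel (Fib)
open OneStepKernelFamily (KInvStep)
open AffineAveraging (Site box toSite)
open AveragingContours (blk off off_mem_box blk_add_off)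
open Summit.QuantumFields.BalabanUV.Beta.HessKerDressedUnits (unitK)
open Summit.QuantumFields.BalabanUV.Beta.AxialDressingRooted (coDressKBmAt)
open Summit.QuantumFields.BalabanUV.Beta.GAN24.CombesThomas (sfStep smStep)
open Summit.QuantumFields.BalabanUV.Beta.GAN24.Push4Iter (LegFam legChain)
open Summit.QuantumFields.BalabanUV.Beta.GAN24.Push4LegTelescopeComb (legChain_neg)
open Summit.QuantumFields.BalabanUV.Beta.GAN24.RespStepBmDecompExact (respStepBmSeq)
open Summit.QuantumFields.BalabanUV.Beta.GAN24.LegStepPush (krow supNorm_sub_comm)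
open Summit.QuantumFields.BalabanUV.Beta.GAN24.LegChainPush (kChain kChain_zero klegDecay_krow)
open Summit.QuantumFields.BalabanUV.Beta.GAN24.DressedLegBlockL1Envelope (exists_legChain_blockL1_envelope)
open Summit.QuantumFields.BalabanUV.Beta.GAN24.DressedLegBlockL1MultiplierColumn (sum_box_abs_comp_mm_le summable_mul_of_decay)
open Summit.QuantumFields.BalabanUV.Beta.GAN24.CarrierKernelLegBlockL1 (kChain_succ_left krowInl_dressed_seq klegDecay_krow_dressed sum_box_abs_mm_le)
open Summit.QuantumFields.BalabanUV.Beta.GAN24.CarrierSlotLegBottomKernel (legChain_congr_from)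

namespace Summit.QuantumFields.BalabanUV.Beta.GAN24.CarrierKernelLegBottomKernel

variable {Lc : ℕ} [NeZero Lc]

/-! ## §1 The dressed row chain composed with an abstract decaying kernel at the bottom -/

/-- NOT IN PRINT; OUR BOOKKEEPING.  **PART 3b WITH THE BOTTOM KERNEL ABSTRACT** (as displayed in the module docstring). -/
theorem exists_chain_comp_bottom_blockL1 (hLc : 2 ≤ Lc) {δM : ℝ} (hδM : 0 < δM) :
    ∃ κ₁ K' : ℝ, 0 < κ₁ ∧ 0 ≤ K' ∧ ∀ (rr : Fin (3 + 1) → ℕ), rr ∈ box (3 + 1) Lc →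
      ∀ (M : MKer (3 + 1) (Fib 3)) (CM : ℝ), 0 ≤ CM → (∀ x y a b, |M x y a b| ≤ CM * Real.exp (-δM * l1 (x - y))) →
      ∀ (m k : ℕ) (α : Fin (3 + 1)) (xs : Site (3 + 1)) (f : Fib 3) (c : Site (3 + 1)),
        ∑ t ∈ box (3 + 1) (Lc ^ (k + 2)),
            |∑' x', ∑ α' : Fin (3 + 1), legChain (respStepBmSeq (d := 3) (toSite rr) Lc) (m + 1) k α xs α' x' *
                M ((Lc : ℤ) • x') (((Lc ^ (k + 2) : ℕ) : ℤ) • c + toSite t) (Sum.inr α') f|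
          ≤ CM * K' * ((k : ℝ) + 1) * ((Lc : ℝ) ^ (k + 1))⁻¹ * Real.exp (-(κ₁ * supNorm (c - xs))) := by
  classical
  have hLc1 : 1 ≤ Lc := le_trans (by norm_num) hLc
  obtain ⟨κ₀, K, hκ₀, hK, hlaw⟩ := exists_legChain_blockL1_envelope (Lc := Lc)
  set κ₁ : ℝ := min κ₀ (δM / 4) with hκ₁
  have hκ₁0 : 0 < κ₁ := lt_min hκ₀ (by positivity)
  have hκ₁κ₀ : κ₁ ≤ κ₀ := min_le_left _ _
  have h4 : 4 * κ₁ ≤ δM := by have := min_le_right κ₀ (δM / 4); rw [← hκ₁] at this; linarith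
  set Z : ℝ := Zl (3 + 1) (δM / 2) * Real.exp (3 * κ₁) * Zl (3 + 1) (κ₁ / ((3 : ℝ) + 1)) with hZ
  have hZ0 : 0 ≤ Z := by
    have := Zl_nonneg (D := 3 + 1) (show 0 < δM / 2 by positivity)
    have := Zl_nonneg (D := 3 + 1) (show 0 < κ₁ / ((3 : ℝ) + 1) by positivity)
    rw [hZ]; positivity
  refine ⟨κ₁, 4 * K * Z, hκ₁0, by positivity, ?_⟩
  intro rr hrr M CM hCM hMd m k α xs f c
  set a : ℝ := K * ((k : ℝ) + 1) * ((Lc : ℝ) ^ (k + 1))⁻¹ with ha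
  have ha0 : 0 ≤ a := by rw [ha]; positivity
  have hA : ∀ (α' : Fin (3 + 1)) (c' : Site (3 + 1)),
      ∑ s ∈ box (3 + 1) (Lc ^ (k + 1)), |legChain (respStepBmSeq (d := 3) (toSite rr) Lc) (m + 1) k α xs α' (((Lc ^ (k + 1) : ℕ) : ℤ) • c' + toSite s)|
        ≤ a * Real.exp (-(κ₁ * supNorm (c' - xs))) := by
    intro α' c'
    refine (hlaw rr hrr (m + 1) k α xs α' c').trans ?_
    rw [ha]
    refine mul_le_mul_of_nonneg_left ?_ (by positivity)
    rw [Real.exp_le_exp]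
    have := supNorm_nonneg (c' - xs)
    nlinarith
  have hM : ∀ (α' : Fin (3 + 1)) (x' x : Site (3 + 1)), |M ((Lc : ℤ) • x') x (Sum.inr α') f| ≤ CM * Real.exp (-δM * l1 ((Lc : ℤ) • x' - x)) :=
    fun α' x' x => hMd _ _ _ _
  have hfib : ∀ α' : Fin (3 + 1), ∑ t ∈ box (3 + 1) (Lc ^ (k + 2)),
      |∑' x', legChain (respStepBmSeq (d := 3) (toSite rr) Lc) (m + 1) k α xs α' x' *
          M ((Lc : ℤ) • x') (((Lc ^ (k + 2) : ℕ) : ℤ) • c + toSite t) (Sum.inr α') f|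
        ≤ a * CM * Z * Real.exp (-(κ₁ * supNorm (c - xs))) := by
    intro α'
    have h := sum_box_abs_comp_mm_le (d := 3) hLc1 k hκ₁0 hδM h4 ha0 hCM xs (hA α') (hM α') c
    refine h.trans (le_of_eq ?_)
    rw [hZ]; ring
  have hAb : ∀ (α' : Fin (3 + 1)) (x' : Site (3 + 1)), |legChain (respStepBmSeq (d := 3) (toSite rr) Lc) (m + 1) k α xs α' x'| ≤ a := by
    intro α' x'
    haveI : NeZero (Lc ^ (k + 1)) := ⟨pow_ne_zero _ (NeZero.ne Lc)⟩
    have hL1 : 1 ≤ Lc ^ (k + 1) := Nat.one_le_pow _ _ hLc1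
    have hx := blk_add_off hL1 x'
    have h1 : |legChain (respStepBmSeq (d := 3) (toSite rr) Lc) (m + 1) k α xs α' x'|
        ≤ ∑ s ∈ box (3 + 1) (Lc ^ (k + 1)), |legChain (respStepBmSeq (d := 3) (toSite rr) Lc) (m + 1) k α xs α' (((Lc ^ (k + 1) : ℕ) : ℤ) • blk (Lc ^ (k + 1)) x' + toSite s)| := by
      conv_lhs => rw [← hx]
      exact Finset.single_le_sum (f := fun s => |legChain (respStepBmSeq (d := 3) (toSite rr) Lc) (m + 1) k α xs α'
        (((Lc ^ (k + 1) : ℕ) : ℤ) • blk (Lc ^ (k + 1)) x' + toSite s)|) (fun _ _ => abs_nonneg _) (off_mem_box hL1 x')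
    refine h1.trans ((hA α' _).trans ?_)
    have : Real.exp (-(κ₁ * supNorm (blk (Lc ^ (k + 1)) x' - xs))) ≤ 1 := by
      rw [Real.exp_le_one_iff]; have := supNorm_nonneg (blk (Lc ^ (k + 1)) x' - xs); nlinarith
    nlinarith
  have hsum : ∀ (α' : Fin (3 + 1)) (x : Site (3 + 1)), Summable fun x' =>
      legChain (respStepBmSeq (d := 3) (toSite rr) Lc) (m + 1) k α xs α' x' * M ((Lc : ℤ) • x') x (Sum.inr α') f :=
    fun α' x => summable_mul_of_decay (d := 3) hLc1 hδM ha0 hCM (hAb α') (hM α') x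
  calc ∑ t ∈ box (3 + 1) (Lc ^ (k + 2)),
          |∑' x', ∑ α' : Fin (3 + 1), legChain (respStepBmSeq (d := 3) (toSite rr) Lc) (m + 1) k α xs α' x' *
              M ((Lc : ℤ) • x') (((Lc ^ (k + 2) : ℕ) : ℤ) • c + toSite t) (Sum.inr α') f|
      = ∑ t ∈ box (3 + 1) (Lc ^ (k + 2)),
          |∑ α' : Fin (3 + 1), ∑' x', legChain (respStepBmSeq (d := 3) (toSite rr) Lc) (m + 1) k α xs α' x' *
              M ((Lc : ℤ) • x') (((Lc ^ (k + 2) : ℕ) : ℤ) • c + toSite t) (Sum.inr α') f| :=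
        Finset.sum_congr rfl fun t _ => by rw [Summable.tsum_finsetSum (fun α' _ => hsum α' _)]
    _ ≤ ∑ t ∈ box (3 + 1) (Lc ^ (k + 2)), ∑ α' : Fin (3 + 1),
          |∑' x', legChain (respStepBmSeq (d := 3) (toSite rr) Lc) (m + 1) k α xs α' x' *
              M ((Lc : ℤ) • x') (((Lc ^ (k + 2) : ℕ) : ℤ) • c + toSite t) (Sum.inr α') f| :=
        Finset.sum_le_sum fun t _ => Finset.abs_sum_le_sum_abs _ _
    _ = ∑ α' : Fin (3 + 1), ∑ t ∈ box (3 + 1) (Lc ^ (k + 2)),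
          |∑' x', legChain (respStepBmSeq (d := 3) (toSite rr) Lc) (m + 1) k α xs α' x' *
              M ((Lc : ℤ) • x') (((Lc ^ (k + 2) : ℕ) : ℤ) • c + toSite t) (Sum.inr α') f| := Finset.sum_comm
    _ ≤ ∑ _α' : Fin (3 + 1), a * CM * Z * Real.exp (-(κ₁ * supNorm (c - xs))) := Finset.sum_le_sum fun α' _ => hfib α'
    _ = CM * (4 * K * Z) * ((k : ℝ) + 1) * ((Lc : ℝ) ^ (k + 1))⁻¹ * Real.exp (-(κ₁ * supNorm (c - xs))) := by
        rw [Finset.sum_const, Finset.card_univ, Fintype.card_fin, nsmul_eq_mul, ha]; push_cast; ring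

/-! ## §2 The composite kernel leg of a family with a swapped bottom kernel -/

/-- [folklore] **THE SWAPPED FAMILY UNROLLED AT ITS FINE END**: for `K′ := update K♮ᴱ p M` with `M` decaying,
`kChain (j ↦ krow K′_j Lc) p (q+1) α x″ f x = (−1)^{q+1}·Σ′_{x′} Σ_{α′} legChain (respStepBmSeq ρ Lc) (p+1) q α x″ α′ x′ · M (Lc•x′) x (inr α′) f`. -/
theorem kChain_update_succ (hLc : 1 ≤ Lc) {rr : Fin (3 + 1) → ℕ} (hrr : rr ∈ box (3 + 1) Lc) {M : MKer (3 + 1) (Fib 3)} {CM δM : ℝ} (hδM : 0 < δM)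
    (hMd : ∀ x y a b, |M x y a b| ≤ CM * Real.exp (-δM * l1 (x - y))) (p q : ℕ) (α : Fin (3 + 1)) (x'' : Site (3 + 1)) (f : Fib 3) (x : Site (3 + 1)) :
    kChain (fun j => krow (Function.update (fun j => unitK (sfStep Lc j) (smStep 3 Lc j) (coDressKBmAt (toSite rr) Lc (KInvStep (d := 3) Lc j))) p M j) Lc) p (q + 1) α x'' f x
      = (-1 : ℝ) ^ (q + 1) * ∑' x', ∑ α' : Fin (3 + 1), legChain (respStepBmSeq (d := 3) (toSite rr) Lc) (p + 1) q α x'' α' x' *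
          M ((Lc : ℤ) • x') x (Sum.inr α') f := by
  -- every leg of the swapped family is localised: the dressed ones by part 4, the bottom one by `hMd`
  have hdec : ∀ j, ∃ C μ : ℝ, 0 < μ ∧ ∀ (α : Fin (3 + 1)) (x' : Site (3 + 1)) (g : Fib 3) (x : Site (3 + 1)),
      |krow (Function.update (fun j => unitK (sfStep Lc j) (smStep 3 Lc j) (coDressKBmAt (toSite rr) Lc (KInvStep (d := 3) Lc j))) p M j) Lc α x' g x|
        ≤ C * Real.exp (-μ * l1 (x - (Lc : ℤ) • x')) := by
    intro j
    by_cases hj : j = p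
    · subst hj
      refine ⟨CM, δM, hδM, fun α x' g x => ?_⟩
      simp only [Function.update_self]
      exact klegDecay_krow (fun x y a b => hMd x y a b) Lc α x' g x
    · obtain ⟨C, μ, hμ, h⟩ := klegDecay_krow_dressed (d := 3) hrr j
      refine ⟨C, μ, hμ, fun α x' g x => ?_⟩
      simp only [Function.update_of_ne hj]
      exact h α x' g x
  rw [kChain_succ_left hLc hdec p q]
  -- the field columns above level `p` are the dressed family's: congruence from `p+1`, then part 4's dictionary
  have hcongr : legChain (fun j => fun (α : Fin (3 + 1)) (x'' : Site (3 + 1)) (α' : Fin (3 + 1)) (x' : Site (3 + 1)) =>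
        krow (Function.update (fun j => unitK (sfStep Lc j) (smStep 3 Lc j) (coDressKBmAt (toSite rr) Lc (KInvStep (d := 3) Lc j))) p M j) Lc α x'' (Sum.inl α') x') (p + 1) q
      = legChain (fun j => fun (α : Fin (3 + 1)) (x'' : Site (3 + 1)) (α' : Fin (3 + 1)) (x' : Site (3 + 1)) =>
        krow (unitK (sfStep Lc j) (smStep 3 Lc j) (coDressKBmAt (toSite rr) Lc (KInvStep (d := 3) Lc j))) Lc α x'' (Sum.inl α') x') (p + 1) q :=
    legChain_congr_from (fun j hj => by
      have hjp : j ≠ p := by omega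
      simp only [Function.update_of_ne hjp]) q
  rw [hcongr, krowInl_dressed_seq, legChain_neg, ← tsum_mul_left]
  refine tsum_congr fun x' => ?_
  simp only [Pi.smul_apply, smul_eq_mul, Finset.mul_sum, mul_assoc, krow, Function.update_self]

/-- [folklore] The length-one window of the swapped family reads the bottom kernel's full row: `kChain (j ↦ krow K′_j Lc) p 0 α x″ f x = M (Lc•x″) x (inr α) f`. -/
theorem kChain_update_zero {rr : Fin (3 + 1) → ℕ} (M : MKer (3 + 1) (Fib 3)) (p : ℕ) (α : Fin (3 + 1)) (x'' : Site (3 + 1)) (f : Fib 3) (x : Site (3 + 1)) :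
    kChain (fun j => krow (Function.update (fun j => unitK (sfStep Lc j) (smStep 3 Lc j) (coDressKBmAt (toSite rr) Lc (KInvStep (d := 3) Lc j))) p M j) Lc) p 0 α x'' f x
      = M ((Lc : ℤ) • x'') x (Sum.inr α) f := by
  simp only [kChain_zero, Function.update_self, krow]

/-! ## §3 The block mass of the composite kernel leg with a swapped bottom kernel -/

/-- NOT IN PRINT; OUR BOOKKEEPING.  **THE CARRIER's COMPOSITE KERNEL LEG WITH AN ARBITRARY DECAYING KERNEL AT ITS LOWEST LEVEL** (as displayed in the module docstring):
for every `δM > 0` ONE rate `κ₁ > 0` and ONE `K₈ ≥ 0` with, for every in-block root, every kernel `M` with `|M x y a b| ≤ CM·e^{−δM|x−y|₁}` (`0 ≤ CM`), every level `p`, length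
`q+1`, row `α x″`, column fibre `f` and block label `c`: `Σ_{t ∈ box (Lc^{q+1})} |kChain (j ↦ krow (update K♮ᴱ p M j) Lc) p q α x″ f (Lc^{q+1}•c + t)| ≤ CM·K₈·(q+1)·e^{−κ₁‖c − x″‖∞}`. -/
theorem exists_kChain_bottomKernel_blockMass (hLc : 2 ≤ Lc) {δM : ℝ} (hδM : 0 < δM) :
    ∃ κ₁ K₈ : ℝ, 0 < κ₁ ∧ 0 ≤ K₈ ∧ ∀ (rr : Fin (3 + 1) → ℕ), rr ∈ box (3 + 1) Lc →
      ∀ (M : MKer (3 + 1) (Fib 3)) (CM : ℝ), 0 ≤ CM → (∀ x y a b, |M x y a b| ≤ CM * Real.exp (-δM * l1 (x - y))) →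
      ∀ (p q : ℕ) (α : Fin (3 + 1)) (x'' : Site (3 + 1)) (f : Fib 3) (c : Site (3 + 1)),
        ∑ t ∈ box (3 + 1) (Lc ^ (q + 1)),
            |kChain (fun j => krow (Function.update (fun j => unitK (sfStep Lc j) (smStep 3 Lc j) (coDressKBmAt (toSite rr) Lc (KInvStep (d := 3) Lc j))) p M j) Lc)
                p q α x'' f (((Lc ^ (q + 1) : ℕ) : ℤ) • c + toSite t)|
          ≤ CM * K₈ * ((q : ℝ) + 1) * Real.exp (-(κ₁ * supNorm (c - x''))) := by
  classical
  have hLc1 : 1 ≤ Lc := le_trans (by norm_num) hLc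
  have hLpos : (0 : ℝ) < (Lc : ℝ) := by exact_mod_cast (show 0 < Lc by omega)
  have hL1 : (1 : ℝ) ≤ Lc := by exact_mod_cast hLc1
  obtain ⟨κ₂, K', hκ₂, hK', hcomp⟩ := exists_chain_comp_bottom_blockL1 (Lc := Lc) hLc hδM
  set κ₁ : ℝ := min κ₂ (δM / 4) with hκ₁
  have hκ₁0 : 0 < κ₁ := lt_min hκ₂ (by positivity)
  have hκ₁κ₂ : κ₁ ≤ κ₂ := min_le_left _ _
  have h4 : 4 * κ₁ ≤ δM := by have := min_le_right κ₂ (δM / 4); rw [← hκ₁] at this; linarith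
  have hZ := Zl_nonneg (D := 3 + 1) (show 0 < δM / 2 by positivity)
  set K₈ : ℝ := K' + Zl (3 + 1) (δM / 2) * Real.exp (2 * κ₁) with hK₈
  have hK₈0 : 0 ≤ K₈ := by rw [hK₈]; positivity
  have hexp : ∀ {κ : ℝ} (s : ℝ), 0 ≤ s → κ₁ ≤ κ → Real.exp (-(κ * s)) ≤ Real.exp (-(κ₁ * s)) := fun s hs hκ => by
    rw [Real.exp_le_exp]; nlinarith
  refine ⟨κ₁, K₈, hκ₁0, hK₈0, ?_⟩
  intro rr hrr M CM hCM hMd p q α x'' f c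
  have hs : 0 ≤ supNorm (c - x'') := supNorm_nonneg _
  cases q with
  | zero =>
    -- the length-one window: the bottom kernel's row alone, block-summed at blocking `Lc`
    simp only [kChain_update_zero, zero_add, pow_one, Nat.cast_zero, mul_one]
    have hM : ∀ x' x, |M ((Lc : ℤ) • x') x (Sum.inr α) f| ≤ CM * Real.exp (-δM * l1 ((Lc : ℤ) • x' - x)) := fun x' x => hMd _ _ _ _
    refine (sum_box_abs_mm_le (d := 3) hLc1 hκ₁0.le hδM h4 hCM hM x'' c).trans ?_
    rw [supNorm_sub_comm c x'']
    have h1 : CM * Zl (3 + 1) (δM / 2) * Real.exp (2 * κ₁) ≤ CM * K₈ := by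
      rw [mul_assoc]; exact mul_le_mul_of_nonneg_left (by rw [hK₈]; linarith) hCM
    have h2 : Real.exp (-(2 * κ₁) * supNorm (c - x'')) ≤ Real.exp (-(κ₁ * supNorm (c - x''))) := by
      rw [Real.exp_le_exp]; nlinarith
    exact mul_le_mul h1 h2 (Real.exp_pos _).le (mul_nonneg hCM hK₈0)
  | succ q =>
    -- length ≥ 2: the dressed chain above, the abstract kernel at the bottom (§1), the sign invisible
    have e : ∀ t, |kChain (fun j => krow (Function.update (fun j => unitK (sfStep Lc j) (smStep 3 Lc j) (coDressKBmAt (toSite rr) Lc (KInvStep (d := 3) Lc j))) p M j) Lc)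
          p (q + 1) α x'' f (((Lc ^ (q + 1 + 1) : ℕ) : ℤ) • c + toSite t)|
        = |∑' x', ∑ α' : Fin (3 + 1), legChain (respStepBmSeq (d := 3) (toSite rr) Lc) (p + 1) q α x'' α' x' *
            M ((Lc : ℤ) • x') (((Lc ^ (q + 2) : ℕ) : ℤ) • c + toSite t) (Sum.inr α') f| := fun t => by
      rw [kChain_update_succ hLc1 hrr hδM hMd, abs_mul, abs_pow, abs_neg, abs_one, one_pow, one_mul]
    simp only [e]
    refine (hcomp rr hrr M CM hCM hMd p q α x'' f c).trans ?_
    -- `CM·K′·(q+1)·(Lc^{q+1})⁻¹ ≤ CM·K₈·(q+2)`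
    have hinv : ((Lc : ℝ) ^ (q + 1))⁻¹ ≤ 1 := inv_le_one_of_one_le₀ (one_le_pow₀ hL1)
    have h1 : CM * K' * ((q : ℝ) + 1) * ((Lc : ℝ) ^ (q + 1))⁻¹ ≤ CM * K₈ * (((q + 1 : ℕ) : ℝ) + 1) := by
      have hK'le : K' ≤ K₈ := by rw [hK₈]; have := mul_nonneg hZ (Real.exp_pos (2 * κ₁)).le; linarith
      calc CM * K' * ((q : ℝ) + 1) * ((Lc : ℝ) ^ (q + 1))⁻¹ ≤ CM * K' * ((q : ℝ) + 1) * 1 :=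
            mul_le_mul_of_nonneg_left hinv (by positivity)
        _ ≤ CM * K₈ * (((q + 1 : ℕ) : ℝ) + 1) := by
            rw [mul_one]
            refine mul_le_mul (mul_le_mul_of_nonneg_left hK'le hCM) (by push_cast; linarith) (by positivity) (mul_nonneg hCM hK₈0)
    exact mul_le_mul h1 (hexp _ hs hκ₁κ₂) (Real.exp_pos _).le (by positivity)

end Summit.QuantumFields.BalabanUV.Beta.GAN24.CarrierKernelLegBottomKernel

end
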